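import Summits.PneNP.PneNP.Theorems.ChebyshevTracialDesignCrossingPlaneRemainder
import Summits.PneNP.PneNP.Theorems.ChebyshevTracialDesignGammaDirectionConditional
import HarnessLib

/-!
# Cell pnp-psdrank, route `ChebyshevTracialDesign`: the γ-direction's new remainders against a constant smoothness bound
# (crux `TracialDecayExp20`, stmt-PneNP-19878)

Brick 134a (prover g26; MEMO-29 §4(b)). Brick 126a (`remainder_le`) majorises brick 120's seven remainders, evaluated at constant smoothness
numbers `X_{D−1} = X_D = X_{D+1} = Ξ` (powers `ρ^k ≤ 1` as `r_i`), by `200·t²·G·((2D+1) + B_v C_b)·Ξ`. Bricks 129/134 add `R₇ + 12R′`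
(brick 129c's `n_A`-moments remainder with `G₂ = 16tG`, `|α| ≤ 4`, and twelve copies of bricks 129b's common bound). This file is the
companion pure-arithmetic majorisation:

* **`newRemainder_le`**: with `r₁, r₂, r₃ ≤ 1`, `cD ≤ 1`, `T ≤ t`, `2D+2 ≤ t`: `R₇ + 12R′ ≤ 100·t²·G·((2D+1) + B_v C_b)·Ξ`;
* **`gammaRemainder_le`**: hence `R₁₂₀ + R₇ + 12R′ ≤ 300·t²·G·((2D+1) + B_v C_b)·Ξ` (brick 126a + the above).
So the asymptotic massaging of brick 134 is brick 126b's numerics verbatim with `200 ↦ 300` (and `T+2 ↦ T+4` in `chernoff_exponent_le`).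
WHAT THIS FILE DOES NOT DO: the asymptotic assembly itself, (ii)/(iii), anything on `TracialDecayExp20` itself, psd rank of P_PM(K_n), or P vs NP.
[cite: Rothvoss2017, §2 (PDF p. 6)] [cite: Agarwal2000DifferenceEquations, Remark 1.8.1 (1.8.8)]
Stature: support/instrument (kernel lane, no defs, axioms standard). Supports stmt-PneNP-19878.
-/

set_option linter.dupNamespace false -- `Summit.PneNP.PneNP.…`: summit = sub-problem (D-0017)

noncomputable section

namespace Summit.PneNP.PneNP.Theorems.ChebyshevTracialDesignGammaDirectionRemainder

open Summit.PneNP.PneNP.Theorems.ChebyshevTracialDesignCrossingPlaneRemainder (remainder_le)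

/-- **The γ-direction's new remainders with constant smoothness numbers.** With `r₁, r₂, r₃ ≤ 1` (the powers `ρ^{D+1}, ρ^D, ρ^{D−1}`),
`cD = C(2D,D)/4^D ≤ 1`, `T ≤ t`, `2D+2 ≤ t`, atoms nonnegative: `R₇ + 12R′ ≤ 100·t²·G·((2D+1) + B_v C_b)·Ξ`.
[cite: Agarwal2000DifferenceEquations, Remark 1.8.1 (1.8.8)] -/
theorem newRemainder_le {Bv Cb tt G r₁ r₂ r₃ Ξ cD DD TT : ℝ} (hBv : 0 ≤ Bv) (hCb : 0 ≤ Cb) (hG : 0 ≤ G)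
    (hr₁ : 0 ≤ r₁) (hr₂ : 0 ≤ r₂) (hr₃ : 0 ≤ r₃) (hΞ : 0 ≤ Ξ) (hDD : 0 ≤ DD) (hTT : 0 ≤ TT)
    (hr₁1 : r₁ ≤ 1) (hr₂1 : r₂ ≤ 1) (hr₃1 : r₃ ≤ 1) (hcD1 : cD ≤ 1) (hTt : TT ≤ tt) (hDt : 2 * DD + 2 ≤ tt) :
    Bv * Cb *
        (16 * tt * G * (tt * (r₁ * Ξ) + 2 * (DD + 1) * (r₂ * Ξ)) +
          4 * (G * (tt * (tt * (r₁ * Ξ) + 2 * (DD + 1) * (r₂ * Ξ)) +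
            2 * (DD + 1) * (tt * (r₂ * Ξ) + 2 * DD * (r₃ * Ξ))))) +
      12 * ((2 * DD + 1) * cD *
          (tt * (G * (r₂ * Ξ)) +
            2 * DD * (G * (r₃ * Ξ))) +
        Bv * Cb *
          (TT * (tt * (G * (r₁ * Ξ)) +
              2 * (DD + 1) * (G * (r₂ * Ξ))) +
            2 * (DD + 1) * (tt * (G * (r₂ * Ξ)) +
              2 * DD * (G * (r₃ * Ξ))))) ≤
      100 * tt ^ 2 * G * ((2 * DD + 1) + Bv * Cb) * Ξ := by
  have htt1 : 1 ≤ tt := by linarith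
  have htt0 : 0 ≤ tt := by linarith
  -- the atoms `r_i Ξ ≤ Ξ`, `cD ≤ 1`, `TT ≤ tt`, `2(DD+1) ≤ tt`, `2DD ≤ tt`
  have e1 : r₁ * Ξ ≤ Ξ := by nlinarith
  have e2 : r₂ * Ξ ≤ Ξ := by nlinarith
  have e3 : r₃ * Ξ ≤ Ξ := by nlinarith
  have hD1 : 2 * (DD + 1) ≤ tt := by linarith
  have hD2 : 2 * DD ≤ tt := by linarith
  have hBC : 0 ≤ Bv * Cb := mul_nonneg hBv hCb
  -- term A (brick 129c's remainder)
  have hA : Bv * Cb *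
        (16 * tt * G * (tt * (r₁ * Ξ) + 2 * (DD + 1) * (r₂ * Ξ)) +
          4 * (G * (tt * (tt * (r₁ * Ξ) + 2 * (DD + 1) * (r₂ * Ξ)) +
            2 * (DD + 1) * (tt * (r₂ * Ξ) + 2 * DD * (r₃ * Ξ))))) ≤
      Bv * Cb * (48 * tt ^ 2 * G * Ξ) := by
    refine mul_le_mul_of_nonneg_left ?_ hBC
    have i1 : tt * (r₁ * Ξ) + 2 * (DD + 1) * (r₂ * Ξ) ≤ 2 * tt * Ξ := by
      have := mul_le_mul hD1 e2 (by positivity) htt0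
      have := mul_le_mul_of_nonneg_left e1 htt0
      linarith
    have i2 : tt * (r₂ * Ξ) + 2 * DD * (r₃ * Ξ) ≤ 2 * tt * Ξ := by
      have := mul_le_mul hD2 e3 (by positivity) htt0
      have := mul_le_mul_of_nonneg_left e2 htt0
      linarith
    have i3 : G * (tt * (tt * (r₁ * Ξ) + 2 * (DD + 1) * (r₂ * Ξ)) + 2 * (DD + 1) * (tt * (r₂ * Ξ) + 2 * DD * (r₃ * Ξ))) ≤
        G * (tt * (2 * tt * Ξ) + tt * (2 * tt * Ξ)) := by
      refine mul_le_mul_of_nonneg_left ?_ hG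
      have := mul_le_mul_of_nonneg_left i1 htt0
      have := mul_le_mul hD1 i2 (by positivity) htt0
      linarith
    have i4 : 16 * tt * G * (tt * (r₁ * Ξ) + 2 * (DD + 1) * (r₂ * Ξ)) ≤ 16 * tt * G * (2 * tt * Ξ) :=
      mul_le_mul_of_nonneg_left i1 (by positivity)
    nlinarith
  -- term B (twelve copies of bricks 129b's bound)
  have hB : 12 * ((2 * DD + 1) * cD *
          (tt * (G * (r₂ * Ξ)) +
            2 * DD * (G * (r₃ * Ξ))) +
        Bv * Cb *
          (TT * (tt * (G * (r₁ * Ξ)) +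
              2 * (DD + 1) * (G * (r₂ * Ξ))) +
            2 * (DD + 1) * (tt * (G * (r₂ * Ξ)) +
              2 * DD * (G * (r₃ * Ξ))))) ≤
      12 * ((2 * DD + 1) * (2 * tt ^ 2 * G * Ξ) + Bv * Cb * (4 * tt ^ 2 * G * Ξ)) := by
    have j1 : tt * (G * (r₂ * Ξ)) + 2 * DD * (G * (r₃ * Ξ)) ≤ 2 * tt * G * Ξ := by
      have := mul_le_mul_of_nonneg_left (mul_le_mul_of_nonneg_left e2 hG) htt0
      have := mul_le_mul hD2 (mul_le_mul_of_nonneg_left e3 hG) (by positivity) htt0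
      linarith
    have j2 : tt * (G * (r₁ * Ξ)) + 2 * (DD + 1) * (G * (r₂ * Ξ)) ≤ 2 * tt * G * Ξ := by
      have := mul_le_mul_of_nonneg_left (mul_le_mul_of_nonneg_left e1 hG) htt0
      have := mul_le_mul hD1 (mul_le_mul_of_nonneg_left e2 hG) (by positivity) htt0
      linarith
    have j3 : (2 * DD + 1) * cD * (tt * (G * (r₂ * Ξ)) + 2 * DD * (G * (r₃ * Ξ))) ≤ (2 * DD + 1) * (2 * tt ^ 2 * G * Ξ) := by
      have hc : (2 * DD + 1) * cD ≤ (2 * DD + 1) * 1 := mul_le_mul_of_nonneg_left hcD1 (by positivity)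
      have h2 : 2 * tt * G * Ξ ≤ 2 * tt ^ 2 * G * Ξ := by
        have htt2 : tt ≤ tt ^ 2 := by nlinarith
        have := mul_le_mul_of_nonneg_right htt2 (mul_nonneg hG hΞ)
        nlinarith [this]
      calc (2 * DD + 1) * cD * (tt * (G * (r₂ * Ξ)) + 2 * DD * (G * (r₃ * Ξ)))
          ≤ (2 * DD + 1) * 1 * (2 * tt * G * Ξ) := mul_le_mul hc j1 (by positivity) (by positivity)
        _ ≤ (2 * DD + 1) * (2 * tt ^ 2 * G * Ξ) := by rw [mul_one]; exact mul_le_mul_of_nonneg_left h2 (by positivity)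
    have j4 : Bv * Cb * (TT * (tt * (G * (r₁ * Ξ)) + 2 * (DD + 1) * (G * (r₂ * Ξ))) +
        2 * (DD + 1) * (tt * (G * (r₂ * Ξ)) + 2 * DD * (G * (r₃ * Ξ)))) ≤ Bv * Cb * (4 * tt ^ 2 * G * Ξ) := by
      refine mul_le_mul_of_nonneg_left ?_ hBC
      have := mul_le_mul hTt j2 (by positivity) htt0
      have := mul_le_mul hD1 j1 (by positivity) htt0
      nlinarith
    linarith
  -- assemble
  have hfin : Bv * Cb * (48 * tt ^ 2 * G * Ξ) + 12 * ((2 * DD + 1) * (2 * tt ^ 2 * G * Ξ) + Bv * Cb * (4 * tt ^ 2 * G * Ξ)) ≤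
      100 * tt ^ 2 * G * ((2 * DD + 1) + Bv * Cb) * Ξ := by
    have h0 : 0 ≤ tt ^ 2 * G * Ξ := by positivity
    nlinarith [mul_nonneg hBC h0, mul_nonneg (by positivity : (0 : ℝ) ≤ 2 * DD + 1) h0]
  linarith

/-- **All remainders of the γ-direction (bricks 129/134) with constant smoothness numbers**: `R₁₂₀ + R₇ + 12R′ ≤ 300·t²·G·((2D+1) + B_v C_b)·Ξ`
(brick 126a's `remainder_le` for `R₁₂₀` plus `newRemainder_le`; `h = |H|/n ≤ 1`, `h₂ = |H|²/(n(n−2)) ≤ 1` as there).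
[cite: Agarwal2000DifferenceEquations, Remark 1.8.1 (1.8.8)] -/
theorem gammaRemainder_le {Bv Cb tt G r₁ r₂ r₃ Ξ cD DD TT h h₂ : ℝ} (hBv : 0 ≤ Bv) (hCb : 0 ≤ Cb) (hG : 0 ≤ G)
    (hr₁ : 0 ≤ r₁) (hr₂ : 0 ≤ r₂) (hr₃ : 0 ≤ r₃) (hΞ : 0 ≤ Ξ) (hDD : 0 ≤ DD) (hTT : 0 ≤ TT)
    (hh : 0 ≤ h) (hh₂ : 0 ≤ h₂) (hr₁1 : r₁ ≤ 1) (hr₂1 : r₂ ≤ 1) (hr₃1 : r₃ ≤ 1) (hcD1 : cD ≤ 1) (hh1 : h ≤ 1)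
    (hh₂1 : h₂ ≤ 1) (hTt : TT ≤ tt) (hDt : 2 * DD + 2 ≤ tt) :
    (Bv * Cb *
          ((9 * tt ^ 2 * G) * (r₁ * Ξ)) +
      2 * ((2 * DD + 1) * cD *
            ((3 * tt * G) * (r₂ * Ξ)) +
          Bv * Cb *
            (TT * ((3 * tt * G) * (r₁ * Ξ)) +
              2 * (DD + 1) * ((3 * tt * G) * (r₂ * Ξ)))) +
      ((2 * DD + 1) * cD *
          (TT * (G * (r₂ * Ξ)) +
            2 * DD * (G * (r₃ * Ξ))) +
        Bv * Cb *
          (TT * (TT * (G * (r₁ * Ξ)) +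
              2 * (DD + 1) * (G * (r₂ * Ξ))) +
            2 * (DD + 1) * (TT * (G * (r₂ * Ξ)) +
              2 * DD * (G * (r₃ * Ξ))))) +
      4 * ((2 * DD + 1) * cD *
            (h * ((3 * tt * G) * (r₂ * Ξ))) +
          Bv * Cb *
            (TT * (h * ((3 * tt * G) *
                (r₁ * Ξ))) +
              2 * (DD + 1) * (h * ((3 * tt * G) *
                (r₂ * Ξ))))) +
      4 * ((2 * DD + 1) * cD *
            (TT * (h * (G * (r₂ * Ξ))) +
              2 * DD * (h * (G * (r₃ * Ξ)))) +
          Bv * Cb *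
            (TT * (TT * (h * (G * (r₁ * Ξ))) +
                2 * (DD + 1) * (h * (G * (r₂ * Ξ)))) +
              2 * (DD + 1) * (TT * (h * (G * (r₂ * Ξ))) +
                2 * DD * (h * (G * (r₃ * Ξ)))))) +
      4 * ((2 * DD + 1) * cD *
            (h * (G * (r₂ * Ξ))) +
          Bv * Cb *
            (TT * (h * (G * (r₁ * Ξ))) +
              2 * (DD + 1) * (h * (G * (r₂ * Ξ))))) +
      4 * ((2 * DD + 1) * cD *
            (h₂ * (G * (TT * (r₂ * Ξ) +
              2 * DD * (r₃ * Ξ)))) +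
          Bv * Cb *
            (TT * (h₂ *
                (G * (TT * (r₁ * Ξ) +
                  2 * (DD + 1) * (r₂ * Ξ)))) +
              2 * (DD + 1) * (h₂ *
                (G * (TT * (r₂ * Ξ) +
                  2 * DD * (r₃ * Ξ))))))) +
      Bv * Cb *
        (16 * tt * G * (tt * (r₁ * Ξ) + 2 * (DD + 1) * (r₂ * Ξ)) +
          4 * (G * (tt * (tt * (r₁ * Ξ) + 2 * (DD + 1) * (r₂ * Ξ)) +
            2 * (DD + 1) * (tt * (r₂ * Ξ) + 2 * DD * (r₃ * Ξ))))) +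
      12 * ((2 * DD + 1) * cD *
          (tt * (G * (r₂ * Ξ)) +
            2 * DD * (G * (r₃ * Ξ))) +
        Bv * Cb *
          (TT * (tt * (G * (r₁ * Ξ)) +
              2 * (DD + 1) * (G * (r₂ * Ξ))) +
            2 * (DD + 1) * (tt * (G * (r₂ * Ξ)) +
              2 * DD * (G * (r₃ * Ξ))))) ≤
      300 * tt ^ 2 * G * ((2 * DD + 1) + Bv * Cb) * Ξ := by
  have h120 := remainder_le hBv hCb hG hr₁ hr₂ hr₃ hΞ hDD hTT hh hh₂ hr₁1 hr₂1 hr₃1 hcD1 hh1 hh₂1 hTt hDt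
  have hnew := newRemainder_le hBv hCb hG hr₁ hr₂ hr₃ hΞ hDD hTT hr₁1 hr₂1 hr₃1 hcD1 hTt hDt
  linarith

end Summit.PneNP.PneNP.Theorems.ChebyshevTracialDesignGammaDirectionRemainder

end
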